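import Mathlib
import Summits.NavierStokesRegularity.FluidComputer.SharpH2Fluxes
import Summits.NavierStokesRegularity.FluidComputer.HighModePoincare
import Literature.Analysis.FunctionSpaces.TorusLinearisedNSEnergy
import Literature.Analysis.FunctionSpaces.TorusLinearisedFormTruncation
import HarnessLib

/-!
# The `H²` tail inequality of THEOREM 3-L with FROBENIUS-structured host constants — the sharp form that certifies (cap g5, cell `ns-blowup`, 2026-08-26)

HONEST FRAMING (human ruling D-0035): nothing here is a claim about Navier–Stokes blow-up.
WHAT THIS IS NOT: not NS evidence. `H2TailDissipativity.tail_form_le` (instab g8, p410014) proves the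
tail inequality of THEOREM 3-L (`instab/INSTAB-BRIDGE.md` §11 l.109) with ENTRYWISE host bounds
`‖∂ₖv‖ ≤ L`, `‖∂ⱼ∂ₖv‖ ≤ L'`, `‖∂ⱼΔv‖ ≤ L''`, whose top-order constant `(2d² + d)L` is `21` for the
rescaled ABC host and does NOT certify at the D2 certificate's `K = 24` (`cap/D2-CHAIN-MAP.md` step
S7 (a): «the sharp paper derivation is load-bearing»). This file proves the SAME inequality with the
host entering only through five pointwise STRUCTURAL constants — Cauchy–Schwarz is done in `ℓ²`
(Frobenius) instead of `ℓ¹ × ℓ^∞`: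

* `s`  — strain:      `|⟪(a·∇)v(x), a⟫| ≤ s‖a‖²` for all `x`, `a` (symmetric part of `∇v`);
* `F`  — gradient:    `∑ⱼ ‖∂ⱼv(x)‖² ≤ F²` (Frobenius norm of `∇v`);
* `L₂` — Laplacian:   `‖Δv(x)‖ ≤ L₂`;
* `P`  — Hessian:     `∑ₘ∑ⱼ ‖∂ⱼ∂ₘv(x)‖² ≤ P²`;
* `Q`  — `∇Δ`:        `∑ⱼ ‖∂ⱼΔv(x)‖² ≤ Q²`.

THEOREM (`sharp_tail_form_le`). For smooth divergence-free `v` with these bounds and a smooth TAIL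
field `w` (`fourierTruncate N w = 0`), with `Λ = 4π²(N² + 1)` and `Y = ∫‖Δw‖²`:
`ν∫⟪ΔΔw, Δw⟫ − ∫⟪(v·∇)w + (w·∇)v, ΔΔw⟫ − ωY ≤ (−νΛ − ω + (2F + s) + (L₂ + 2P)Λ^{-1/2} + QΛ^{-1}) · Y`.
For `U = abc(1,1,1)` on `(ℝ/2πℤ)³` the five constants are `s = √2` (Lemma S,
`SkewCutCertificate.abc_strain_form_abs_le`), `F = √3` (`|∇U|_F² = 3` pointwise), `L₂ = √6`
(`ΔU = −U`, `|U|² ≤ 6`), `P = √3` (pure second derivatives of unit length, mixed ones zero,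
`AbcH2TailConstants.abc_dxx_sq`), `Q = √3` (`∇ΔU = −∇U`), giving EXACTLY the paper's
`c₀ = 2√3 + √2`, `c₁ = √6 + 2√3`, `c₂ = √3` used by `AbcKappa0TailLevels` / the D2 certificates
(after the `2π`-rescaling to the unit torus, which multiplies a `j`-th derivative constant by `(2π)ʲ`
and `Λ^{1/2}` plays `2π(K+1)`; that instantiation sentence stays S7 (c)).

* `norm_sum_convect_le_sqrt_mul_sqrt` — pointwise `‖∑ₘ (Aₘ·∇)Bₘ‖ ≤ (∑ₘ‖Aₘ‖²)^{1/2}(∑ₘ∑ⱼ‖∂ⱼBₘ‖²)^{1/2}`.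
* `abs_integral_inner_convect_bilaplacian_le_frob` — transport half:
  `|∫⟪(v·∇)w, ΔΔw⟫| ≤ (2F·‖Δw‖₂ + L₂·‖∇w‖₂)·‖Δw‖₂`.
* `abs_integral_inner_stretch_bilaplacian_le_frob` — stretching half:
  `|∫⟪(w·∇)v, ΔΔw⟫| ≤ (Q‖w‖₂ + 2P‖∇w‖₂ + s‖Δw‖₂)·‖Δw‖₂`.
* `sharp_tail_form_le` — the tail inequality above.

Mathlib + the landed torus calculus (`LaplacianConvectCommutator`, `LaplacianConvectFlux`,
`HighModePoincare`, `Torus*`); no new definitions.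
-/

noncomputable section

namespace Summit.NavierStokesRegularity.FluidComputer.SharpH2TailDissipativity

open Literature.Analysis.FunctionSpaces Literature.Analysis.FunctionSpaces.Torus MeasureTheory
open Summit.NavierStokesRegularity.FluidComputer.LaplacianConvectCommutator
open Summit.NavierStokesRegularity.FluidComputer.HighModePoincare
open scoped RealInnerProductSpace

variable {d : Type*} [Fintype d] [DecidableEq d]
open Summit.NavierStokesRegularity.FluidComputer.SharpH2Fluxes

/-! ## The tail inequality -/

/-- **THEOREM 3-L, tail inequality, with Frobenius-structured host constants (the form that
certifies).** For a smooth divergence-free host `v` with strain `s`, gradient `F`, Laplacian `L₂`,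
Hessian `P` and `∇Δ` bound `Q` (module docstring), and a smooth TAIL field `w` (no Fourier modes in
the ball `|k|² ≤ N²`), with `Λ = 4π²(N² + 1)`:
`ν∫⟪ΔΔw, Δw⟫ − ∫⟪(v·∇)w + (w·∇)v, ΔΔw⟫ − ω‖Δw‖₂² ≤ (−νΛ − ω + (2F + s) + (L₂ + 2P)Λ^{-1/2} + QΛ^{-1})·‖Δw‖₂²`.
For `U = abc(1,1,1)`: `2F + s = 2√3 + √2`, `L₂ + 2P = √6 + 2√3`, `Q = √3` — the paper's
`c₀, c₁, c₂` of INSTAB-BRIDGE §11 l.109 (vs `(2d² + d)L = 21` in the entrywise form). -/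
theorem sharp_tail_form_le {v w : UnitAddTorus d → EuclideanSpace ℝ d}
    (hv : IsSmooth v) (hdiv : IsDivFree v) (hw : IsSmooth w) {N : ℕ}
    (h0 : fourierTruncate N w = fun _ => 0) {ν ω s F L₂ P Q : ℝ} (hν : 0 ≤ ν)
    (hF0 : 0 ≤ F) (hP0 : 0 ≤ P) (hQ0 : 0 ≤ Q)
    (hS : ∀ (x : UnitAddTorus d) (a : EuclideanSpace ℝ d),
      |⟪∑ j, a j • partialDeriv j v x, a⟫| ≤ s * ‖a‖ ^ 2)
    (hF : ∀ x : UnitAddTorus d, ∑ j, ‖partialDeriv j v x‖ ^ 2 ≤ F ^ 2)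
    (hL₂ : ∀ x : UnitAddTorus d, ‖laplacian v x‖ ≤ L₂)
    (hP : ∀ x : UnitAddTorus d, ∑ m, ∑ j, ‖partialDeriv j (partialDeriv m v) x‖ ^ 2 ≤ P ^ 2)
    (hQ : ∀ x : UnitAddTorus d, ∑ j, ‖partialDeriv j (laplacian v) x‖ ^ 2 ≤ Q ^ 2) :
    ν * (∫ x, ⟪laplacian (laplacian w) x, laplacian w x⟫)
      - (∫ x, ⟪convect v w x + convect w v x, laplacian (laplacian w) x⟫)
      - ω * (∫ x, ‖laplacian w x‖ ^ 2)
      ≤ (-(ν * (4 * Real.pi ^ 2 * ((N : ℝ) ^ 2 + 1))) - ω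
          + (2 * F + s)
          + (L₂ + 2 * P) / Real.sqrt (4 * Real.pi ^ 2 * ((N : ℝ) ^ 2 + 1))
          + Q / (4 * Real.pi ^ 2 * ((N : ℝ) ^ 2 + 1)))
        * (∫ x, ‖laplacian w x‖ ^ 2) := by
  set Λ : ℝ := 4 * Real.pi ^ 2 * ((N : ℝ) ^ 2 + 1) with hΛ
  set Y : ℝ := ∫ x, ‖laplacian w x‖ ^ 2 with hY
  have hΛpos : 0 < Λ := by positivity
  have hY0 : 0 ≤ Y := integral_nonneg fun x => sq_nonneg _
  have hsΛ : 0 < Real.sqrt Λ := Real.sqrt_pos.mpr hΛpos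
  have hL20 : 0 ≤ L₂ := (norm_nonneg _).trans (hL₂ (0 : UnitAddTorus d))
  have hΔw : IsSmooth (laplacian w) := hw.laplacian
  -- (1) viscous term
  have hvisc : ∫ x, ⟪laplacian (laplacian w) x, laplacian w x⟫ ≤ -(Λ * Y) := by
    rw [integral_inner_laplacian_self_eq_neg_gradNormSq_of_isSmooth hΔw]
    have h := integral_norm_laplacian_sq_le_of_truncate_eq_zero hw h0
    linarith
  -- (2) Poincaré for the tail
  have hG : gradNormSq w ≤ Y / Λ := by
    rw [le_div_iff₀ hΛpos, mul_comm]
    exact gradNormSq_le_of_truncate_eq_zero hw h0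
  have hwL2 : ∫ x, ‖w x‖ ^ 2 ≤ Y / Λ ^ 2 := by
    have h1 := integral_norm_sq_le_of_truncate_eq_zero hw h0
    have h2 : Λ * ∫ x, ‖w x‖ ^ 2 ≤ Y / Λ := h1.trans hG
    rw [le_div_iff₀ hΛpos] at h2
    rw [le_div_iff₀ (by positivity)]
    nlinarith
  have hsqY : Real.sqrt Y ^ 2 = Y := Real.sq_sqrt hY0
  have hs_g : Real.sqrt (gradNormSq w) ≤ Real.sqrt Y / Real.sqrt Λ := by
    rw [← Real.sqrt_div hY0]; exact Real.sqrt_le_sqrt hG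
  have hs_w : Real.sqrt (∫ x, ‖w x‖ ^ 2) ≤ Real.sqrt Y / Λ := by
    have h := Real.sqrt_le_sqrt hwL2
    rwa [Real.sqrt_div hY0, Real.sqrt_sq hΛpos.le] at h
  -- (3) the two flux halves
  have h1 := abs_integral_inner_convect_bilaplacian_le_frob hv hdiv hw hF0 hF hL₂
  have h2 := abs_integral_inner_stretch_bilaplacian_le_frob hv hw hP0 hQ0 hS hP hQ
  have hΔΔ : IsSmooth (laplacian (laplacian w)) := hw.laplacian.laplacian
  have hi1 : Integrable (fun x => ⟪convect v w x, laplacian (laplacian w) x⟫) volume :=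
    (((hv.convect hw).continuous).inner hΔΔ.continuous).integrable_of_hasCompactSupport
      (HasCompactSupport.of_compactSpace _)
  have hi2 : Integrable (fun x => ⟪convect w v x, laplacian (laplacian w) x⟫) volume :=
    (((hw.convect hv).continuous).inner hΔΔ.continuous).integrable_of_hasCompactSupport
      (HasCompactSupport.of_compactSpace _)
  have e : ∫ x, ⟪convect v w x + convect w v x, laplacian (laplacian w) x⟫
      = (∫ x, ⟪convect v w x, laplacian (laplacian w) x⟫)
        + ∫ x, ⟪convect w v x, laplacian (laplacian w) x⟫ := by
    simp_rw [inner_add_left]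
    exact integral_add hi1 hi2
  have hsY0 : 0 ≤ Real.sqrt Y := Real.sqrt_nonneg _
  set B : ℝ := (2 * F + s) + (L₂ + 2 * P) / Real.sqrt Λ + Q / Λ with hB
  have hbr : (2 * F * Real.sqrt Y + L₂ * Real.sqrt (gradNormSq w))
        + (Q * Real.sqrt (∫ x, ‖w x‖ ^ 2) + 2 * P * Real.sqrt (gradNormSq w) + s * Real.sqrt Y)
        ≤ B * Real.sqrt Y := by
    have e2 : L₂ * Real.sqrt (gradNormSq w) ≤ L₂ * (Real.sqrt Y / Real.sqrt Λ) :=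
      mul_le_mul_of_nonneg_left hs_g hL20
    have e3 : Q * Real.sqrt (∫ x, ‖w x‖ ^ 2) ≤ Q * (Real.sqrt Y / Λ) := mul_le_mul_of_nonneg_left hs_w hQ0
    have e4 : 2 * P * Real.sqrt (gradNormSq w) ≤ 2 * P * (Real.sqrt Y / Real.sqrt Λ) :=
      mul_le_mul_of_nonneg_left hs_g (by linarith)
    have hsum := add_le_add (add_le_add (le_refl (2 * F * Real.sqrt Y)) e2)
      (add_le_add (add_le_add e3 e4) (le_refl (s * Real.sqrt Y)))
    refine hsum.trans (le_of_eq ?_)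
    simp only [hB]
    field_simp
    ring
  have hflux : |∫ x, ⟪convect v w x + convect w v x, laplacian (laplacian w) x⟫| ≤ B * Y := by
    rw [e]
    have h12 := (abs_add_le _ _).trans (add_le_add h1 h2)
    have h3 : (2 * F * Real.sqrt Y + L₂ * Real.sqrt (gradNormSq w)) * Real.sqrt Y
        + (Q * Real.sqrt (∫ x, ‖w x‖ ^ 2) + 2 * P * Real.sqrt (gradNormSq w) + s * Real.sqrt Y)
          * Real.sqrt Y ≤ B * Real.sqrt Y * Real.sqrt Y := by
      rw [← add_mul]; exact mul_le_mul_of_nonneg_right hbr hsY0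
    have e' : B * Real.sqrt Y * Real.sqrt Y = B * Y := by rw [mul_assoc, ← sq, hsqY]
    rw [e'] at h3
    exact h12.trans h3
  -- (4) assemble
  have hT : -(∫ x, ⟪convect v w x + convect w v x, laplacian (laplacian w) x⟫) ≤ B * Y :=
    (neg_le_abs _).trans hflux
  have hv' : ν * (∫ x, ⟪laplacian (laplacian w) x, laplacian w x⟫) ≤ -(ν * (Λ * Y)) := by
    have := mul_le_mul_of_nonneg_left hvisc hν; linarith
  have key : ν * (∫ x, ⟪laplacian (laplacian w) x, laplacian w x⟫)
      - (∫ x, ⟪convect v w x + convect w v x, laplacian (laplacian w) x⟫)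
      - ω * Y ≤ (-(ν * Λ) - ω + B) * Y := by nlinarith
  have eB : (-(ν * Λ) - ω + B) * Y
      = (-(ν * Λ) - ω + (2 * F + s) + (L₂ + 2 * P) / Real.sqrt Λ + Q / Λ) * Y := by
    simp only [hB]; ring
  rw [eB] at key
  exact key

end Summit.NavierStokesRegularity.FluidComputer.SharpH2TailDissipativity
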